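import Literature.Computability.QuantumComplexity.RevPredicates
import Literature.Computability.QuantumComplexity.JonesLocalGateCircuit
import HarnessLib

/-!
# The sign predicates of the four AJL rotation gadgets and their entry bounds

Topic `Literature/Computability/QuantumComplexity`; a step in the discharge of
`ajl_jonesApproxProblem_mem_PromiseBQP`. The hypothesis `hent` of `GadgetAssembly.rotGadget_implOn` —
the averages `1 − 2·#{n < 2^k | σ bb zt zf n}/2^k` are entrywise close to `−U zf` — is discharged
for the controlled golden-ratio rotations `U = if zf then G else 1`, `G ∈ {G₂, G₂ᵀ, G₃, G₃ᵀ}`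
(`JonesLocalGateCircuit.lean`), with the sign predicate assembled from the thresholds of
`RevPredicates.lean`:

* `SLP.EncodesEntry k p v` — the Boolean expression `p` (reading only `n = inp mod 2^k`) has
  `|1 − 2#{p}/2^k − v| ≤ 2/2^k`; instances: `thr1B ↦ 1/φ`, `thr2B ↦ 1/√φ`, `thr0B ↦ 0`,
  `trueB ↦ −1`, and `not p ↦ −v` (`encodesEntry_*`);
* `SLP.rotSignB k ctl pd p10 p01` — the case split on a control condition `ctl` reading only
  bits `≥ k+2` (`BExpr.ReadsHigh`), the column bit `bb` (bit `k`) and the target bit `zt` (bit `k+1`);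
* `SLP.rotSign_entry_bound` — the `hent` hypothesis with `η = 2/2^k` for
  `U = if ctl then M else 1` given encodings of `−d`, `−g₁₀`, `−g₀₁`; `SLP.phaseSignB`,
  `SLP.phaseSign_entry_bound` — the phase analogue (`η = 4/2^k`).

## References

* D. Aharonov, V. Jones, Z. Landau, Algorithmica 55 (2009), Claim 4.1, Thm. 4.3
  [AharonovJonesLandau2009].
-/

noncomputable section

namespace Literature.Computability.QuantumComplexity

namespace SLP

open Real Finset

/-! ### Boolean-expression combinators -/

/-- `if c then x else y`. [folklore] -/
def iteB (c x y : BExpr) : BExpr := .or (.and c x) (.and (.not c) y)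

/-- The constant `true` (as `bit ∨ ¬bit`). [folklore] -/
def trueB (k : ℕ) : BExpr := .or (bitB k) (.not (bitB k))

variable (inp : ℕ)

/-- Semantics of `iteB`. [folklore] -/
@[simp] theorem iteB_eval (c x y : BExpr) : (iteB c x y).eval inp = (if c.eval inp then x.eval inp else y.eval inp) := by
  simp only [iteB, BExpr.eval]; cases c.eval inp <;> simp

/-- Semantics of `trueB`. [folklore] -/
@[simp] theorem trueB_eval (k : ℕ) : (trueB k).eval inp = true := by
  simp only [trueB, BExpr.eval]; cases (bitB k).eval inp <;> simp

/-! ### Expressions reading only high bits -/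

/-- The arithmetic expression reads only input bits at positions `≥ k` (or nothing). [folklore] -/
def AExpr.ReadsHigh (k : ℕ) : AExpr → Prop
  | .fld off len => len = 0 ∨ k ≤ off
  | .pw _ => True
  | .add e₁ e₂ _ => e₁.ReadsHigh k ∧ e₂.ReadsHigh k
  | .mul e₁ e₂ => e₁.ReadsHigh k ∧ e₂.ReadsHigh k

/-- The Boolean expression reads only input bits at positions `≥ k`. [folklore] -/
def BExpr.ReadsHigh (k : ℕ) : BExpr → Prop
  | .lt e₁ e₂ => e₁.ReadsHigh k ∧ e₂.ReadsHigh k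
  | .not b => b.ReadsHigh k
  | .and b₁ b₂ => b₁.ReadsHigh k ∧ b₂.ReadsHigh k
  | .or b₁ b₂ => b₁.ReadsHigh k ∧ b₂.ReadsHigh k

/-- **High-reading expressions ignore the low `k` bits.** [folklore] -/
theorem AExpr.eval_eq_of_readsHigh {k : ℕ} : ∀ (e : AExpr), e.ReadsHigh k → ∀ {hi n : ℕ}, n < 2 ^ k → e.eval (2 ^ k * hi + n) = e.eval (2 ^ k * hi)
  | .fld off len, h, hi, n, hn => by
    rcases h with h | h
    · subst h; simp [AExpr.eval, Nat.mod_one]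
    · simp only [AExpr.eval]
      obtain ⟨d, rfl⟩ : ∃ d, off = k + d := ⟨off - k, by omega⟩
      rw [pow_add, ← Nat.div_div_eq_div_mul, ← Nat.div_div_eq_div_mul, Nat.add_comm, Nat.add_mul_div_left _ _ (Nat.two_pow_pos k),
        Nat.div_eq_of_lt hn, zero_add, Nat.mul_div_cancel_left _ (Nat.two_pow_pos k)]
  | .pw _, _, _, _, _ => rfl
  | .add e₁ e₂ sh, h, hi, n, hn => by simp only [AExpr.eval, e₁.eval_eq_of_readsHigh h.1 hn, e₂.eval_eq_of_readsHigh h.2 hn]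
  | .mul e₁ e₂, h, hi, n, hn => by simp only [AExpr.eval, e₁.eval_eq_of_readsHigh h.1 hn, e₂.eval_eq_of_readsHigh h.2 hn]

/-- **High-reading Boolean expressions ignore the low `k` bits.** [folklore] -/
theorem BExpr.eval_eq_of_readsHigh {k : ℕ} : ∀ (b : BExpr), b.ReadsHigh k → ∀ {hi n : ℕ}, n < 2 ^ k → b.eval (2 ^ k * hi + n) = b.eval (2 ^ k * hi)
  | .lt e₁ e₂, h, hi, n, hn => by simp only [BExpr.eval, e₁.eval_eq_of_readsHigh h.1 hn, e₂.eval_eq_of_readsHigh h.2 hn]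
  | .not b, h, hi, n, hn => by simp only [BExpr.eval, b.eval_eq_of_readsHigh h hn]
  | .and b₁ b₂, h, hi, n, hn => by simp only [BExpr.eval, b₁.eval_eq_of_readsHigh h.1 hn, b₂.eval_eq_of_readsHigh h.2 hn]
  | .or b₁ b₂, h, hi, n, hn => by simp only [BExpr.eval, b₁.eval_eq_of_readsHigh h.1 hn, b₂.eval_eq_of_readsHigh h.2 hn]

/-- Monotonicity of `ReadsHigh` in the cut. [folklore] -/
theorem AExpr.ReadsHigh.mono {k k' : ℕ} (hk : k ≤ k') : ∀ {e : AExpr}, e.ReadsHigh k' → e.ReadsHigh k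
  | .fld _ _, h => h.imp id (fun h => hk.trans h)
  | .pw _, _ => trivial
  | .add _ _ _, h => ⟨AExpr.ReadsHigh.mono hk h.1, AExpr.ReadsHigh.mono hk h.2⟩
  | .mul _ _, h => ⟨AExpr.ReadsHigh.mono hk h.1, AExpr.ReadsHigh.mono hk h.2⟩

/-- Monotonicity of `ReadsHigh` in the cut. [folklore] -/
theorem BExpr.readsHigh_mono {k k' : ℕ} (hk : k ≤ k') : ∀ (b : BExpr), b.ReadsHigh k' → b.ReadsHigh k
  | .lt _ _, h => ⟨AExpr.ReadsHigh.mono hk h.1, AExpr.ReadsHigh.mono hk h.2⟩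
  | .not b, h => BExpr.readsHigh_mono hk b h
  | .and b₁ b₂, h => ⟨BExpr.readsHigh_mono hk b₁ h.1, BExpr.readsHigh_mono hk b₂ h.2⟩
  | .or b₁ b₂, h => ⟨BExpr.readsHigh_mono hk b₁ h.1, BExpr.readsHigh_mono hk b₂ h.2⟩

/-- A bit test at position `off ≥ k` reads high. [folklore] -/
theorem bitB_readsHigh {k off : ℕ} (h : k ≤ off) : (bitB off).ReadsHigh k := ⟨Or.inl rfl, Or.inr h⟩

/-- `iteB` of high readers reads high. [folklore] -/
theorem iteB_readsHigh {k : ℕ} {c x y : BExpr} (hc : c.ReadsHigh k) (hx : x.ReadsHigh k) (hy : y.ReadsHigh k) : (iteB c x y).ReadsHigh k :=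
  ⟨⟨hc, hx⟩, ⟨hc, hy⟩⟩

/-! ### Encoding an entry by a predicate -/

variable {inp}

/-- The count of a predicate over the averaging register, for fixed high bits `hi`. [folklore] -/
def cnt (k : ℕ) (p : BExpr) (hi : ℕ) : ℕ := ((Finset.range (2 ^ k)).filter fun n => p.eval (2 ^ k * hi + n) = true).card

/-- `p` encodes the entry `v`: `|1 − 2·cnt/2^k − v| ≤ 2/2^k`, whatever the high bits. [folklore] -/
def EncodesEntry (k : ℕ) (p : BExpr) (v : ℝ) : Prop := ∀ hi : ℕ, |(1 - 2 * (cnt k p hi : ℝ) / 2 ^ k) - v| ≤ 2 / 2 ^ k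

/-- The low field of `2^k·hi + n` is `n`. [folklore] -/
theorem mod_field {k hi n : ℕ} (hn : n < 2 ^ k) : (2 ^ k * hi + n) % 2 ^ k = n := by
  rw [Nat.add_mod, Nat.mul_mod_right, zero_add, Nat.mod_mod, Nat.mod_eq_of_lt hn]

/-- **Threshold predicates encode `1 − 2τ`.** [folklore] -/
theorem encodesEntry_of_threshold {k : ℕ} {p : BExpr} {τ : ℝ} (h0 : 0 ≤ τ) (h1 : τ ≤ 1)
    (hp : ∀ inp, p.eval inp = decide (((inp % 2 ^ k : ℕ) : ℝ) < 2 ^ k * τ)) : EncodesEntry k p (1 - 2 * τ) := by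
  intro hi
  have hc : cnt k p hi = ((Finset.range (2 ^ k)).filter fun a : ℕ => (a : ℝ) < 2 ^ k * τ).card := by
    unfold cnt
    congr 1
    refine Finset.filter_congr fun n hn => ?_
    rw [hp, mod_field (Finset.mem_range.1 hn), decide_eq_true_iff]
  have hk : (0 : ℝ) < 2 ^ k := by positivity
  have := card_filter_lt_real k h0 h1
  rw [hc]
  rw [show (1 - 2 * (((Finset.range (2 ^ k)).filter fun a : ℕ => (a : ℝ) < 2 ^ k * τ).card : ℝ) / 2 ^ k) - (1 - 2 * τ) =
    (-2 / 2 ^ k) * ((((Finset.range (2 ^ k)).filter fun a : ℕ => (a : ℝ) < 2 ^ k * τ).card : ℝ) - 2 ^ k * τ) by field_simp; ring]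
  rw [abs_mul, abs_div, abs_neg, abs_two, abs_of_pos hk]
  calc 2 / 2 ^ k * |((((Finset.range (2 ^ k)).filter fun a : ℕ => (a : ℝ) < 2 ^ k * τ).card : ℝ)) - 2 ^ k * τ|
      ≤ 2 / 2 ^ k * 1 := mul_le_mul_of_nonneg_left this (by positivity)
    _ = 2 / 2 ^ k := mul_one _

/-- **Negation negates the encoded entry.** [folklore] -/
theorem EncodesEntry.not {k : ℕ} {p : BExpr} {v : ℝ} (h : EncodesEntry k p v) : EncodesEntry k (.not p) (-v) := by
  intro hi
  have hc : (cnt k (.not p) hi : ℝ) = 2 ^ k - cnt k p hi := by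
    unfold cnt
    have := Finset.card_filter_add_card_filter_not (s := Finset.range (2 ^ k)) (fun n => p.eval (2 ^ k * hi + n) = true)
    rw [Finset.card_range] at this
    have e : ((Finset.range (2 ^ k)).filter fun n => (BExpr.not p).eval (2 ^ k * hi + n) = true) =
        (Finset.range (2 ^ k)).filter fun n => ¬ p.eval (2 ^ k * hi + n) = true := Finset.filter_congr fun n _ => by simp [BExpr.eval]
    rw [e]
    have := congrArg (fun m : ℕ => (m : ℝ)) this
    push_cast at this ⊢
    linarith
  rw [hc]
  have := h hi
  rw [show (1 - 2 * ((2 : ℝ) ^ k - cnt k p hi) / 2 ^ k) - -v = -((1 - 2 * (cnt k p hi : ℝ) / 2 ^ k) - v) by field_simp; ring, abs_neg]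
  exact this

/-- The constant `true` encodes `−1`. [folklore] -/
theorem encodesEntry_trueB (k j : ℕ) : EncodesEntry k (trueB j) (-1) := by
  intro hi
  have : cnt k (trueB j) hi = 2 ^ k := by unfold cnt; simp
  rw [this]; push_cast
  rw [show (1 - 2 * (2 : ℝ) ^ k / 2 ^ k) - -1 = 0 by field_simp; ring, abs_zero]; positivity

/-- `T₀` encodes `0`. [folklore] -/
theorem encodesEntry_thr0B (k : ℕ) : EncodesEntry k (thr0B k) 0 := by
  have := encodesEntry_of_threshold (k := k) (p := thr0B k) (τ := 1 / 2) (by norm_num) (by norm_num) (fun inp => thr0B_eval inp k)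
  norm_num at this; exact this

/-- `T₁` encodes `1/φ`. [folklore] -/
theorem encodesEntry_thr1B (k : ℕ) : EncodesEntry k (thr1B k) goldenRatio⁻¹ := by
  rw [← one_sub_two_mul_tau1]
  exact encodesEntry_of_threshold tau_mem_unitInterval.1.1 tau_mem_unitInterval.1.2 (fun inp => thr1B_eval inp k)

/-- `T₂` encodes `1/√φ`. [folklore] -/
theorem encodesEntry_thr2B (k : ℕ) : EncodesEntry k (thr2B k) (1 / Real.sqrt goldenRatio) := by
  rw [← one_sub_two_mul_tau2]
  exact encodesEntry_of_threshold tau_mem_unitInterval.2.1.1 tau_mem_unitInterval.2.1.2 (fun inp => thr2B_eval inp k)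

/-! ### The sign predicate of a controlled rotation and its entry bound -/

/-- **The sign predicate of a controlled real rotation**: the control condition `ctl` (reading only
bits `≥ k + 2`), the column bit (`k`) and the target bit (`k+1`) select the diagonal predicate `pd`, the `(1,0)` predicate `p10`,
the `(0,1)` predicate `p01`, or (control off) the identity block (`true` on the diagonal = entry
`−1` of `−1`, `T₀` off the diagonal = entry `0`). [cite: AharonovJonesLandau2009, Claim 4.1] -/
def rotSignB (k : ℕ) (ctl pd p10 p01 : BExpr) : BExpr :=
  iteB ctl (iteB (bitB k) (iteB (bitB (k + 1)) p01 p10) pd) (iteB (bitB k) (thr0B k) (trueB k))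

/-- The gadget input split as `bb + 2·zt + 4·rest` above the averaging field. [folklore] -/
def hiOf (bb zt : Bool) (rest : ℕ) : ℕ := bb.toNat + 2 * zt.toNat + 4 * rest

/-- The low control bits of the gadget input. [folklore] -/
theorem testBit_hiOf (k : ℕ) (bb zt : Bool) (rest : ℕ) {n : ℕ} (hn : n < 2 ^ k) :
    (2 ^ k * hiOf bb zt rest + n).testBit k = bb ∧ (2 ^ k * hiOf bb zt rest + n).testBit (k + 1) = zt := by
  have h0 : (hiOf bb zt rest).testBit 0 = bb := by
    rw [hiOf, Nat.testBit_zero]; cases bb <;> cases zt <;> simp <;> omega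
  have h1 : (hiOf bb zt rest).testBit 1 = zt := by
    rw [hiOf, Nat.testBit_succ, Nat.testBit_zero]; cases bb <;> cases zt <;> simp <;> omega
  refine ⟨?_, ?_⟩ <;> rw [Nat.testBit_two_pow_mul_add _ hn] <;> simp [h0, h1]

/-- The gadget input as `2^{k+2}·rest + low` with `low < 2^{k+2}`. [folklore] -/
theorem split_hiOf (k : ℕ) (bb zt : Bool) (rest : ℕ) {n : ℕ} (hn : n < 2 ^ k) :
    2 ^ k * hiOf bb zt rest + n = 2 ^ (k + 2) * rest + (2 ^ k * (bb.toNat + 2 * zt.toNat) + n) ∧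
      2 ^ k * (bb.toNat + 2 * zt.toNat) + n < 2 ^ (k + 2) := by
  constructor
  · rw [hiOf, pow_add]; ring
  · have : bb.toNat + 2 * zt.toNat ≤ 3 := by cases bb <;> cases zt <;> simp
    rw [pow_add]; nlinarith [Nat.two_pow_pos k]

/-- **The entry bound of a controlled rotation gadget** (`η = 2/2^k`). With `U = if C then M else 1`
(`C` the value of the control condition, which reads only bits `≥ k+2`), `M` with diagonal `d`,
entries `g₁₀` at `(1,0)` and `g₀₁` at `(0,1)`, and predicates encoding `−d`, `−g₁₀`, `−g₀₁`:
`‖(1 − 2#{σ}/2^k) − (−U (bb ⊕ zt) zt)‖ ≤ 2/2^k`. [cite: AharonovJonesLandau2009, Claim 4.1 and Thm. 4.3] -/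
theorem rotSign_entry_bound (k : ℕ) {ctl pd p10 p01 : BExpr} (hctl : ctl.ReadsHigh (k + 2)) {d g10 g01 : ℝ}
    (hd : EncodesEntry k pd (-d)) (h10 : EncodesEntry k p10 (-g10)) (h01 : EncodesEntry k p01 (-g01))
    (M : Matrix (Cryptography.QReg 1) (Cryptography.QReg 1) ℂ)
    (hM : ∀ x y : Cryptography.QReg 1, M x y = if x 0 = y 0 then (d : ℂ) else if x 0 = true then (g10 : ℂ) else (g01 : ℂ))
    (bb zt : Bool) (rest : ℕ) :
    ‖((1 : ℂ) - 2 * (((Finset.range (2 ^ k)).filter fun n =>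
        (rotSignB k ctl pd p10 p01).eval (2 ^ k * hiOf bb zt rest + n) = true).card : ℂ) / 2 ^ k) -
      (-(if ctl.eval (2 ^ (k + 2) * rest) then M else (1 : Matrix (Cryptography.QReg 1) (Cryptography.QReg 1) ℂ))
        (fun _ => bb ^^ zt) (fun _ => zt))‖ ≤ 2 / 2 ^ k := by
  set C := ctl.eval (2 ^ (k + 2) * rest) with hC
  have hCn : ∀ n, n < 2 ^ k → ctl.eval (2 ^ k * hiOf bb zt rest + n) = C := by
    intro n hn
    obtain ⟨e, hlt⟩ := split_hiOf k bb zt rest hn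
    rw [e, ctl.eval_eq_of_readsHigh hctl hlt]
  -- the predicate selected by the three bits
  set q : BExpr := if C then (if bb then (if zt then p01 else p10) else pd) else (if bb then thr0B k else trueB k) with hq
  have hsel : ∀ n, n < 2 ^ k → (rotSignB k ctl pd p10 p01).eval (2 ^ k * hiOf bb zt rest + n) = q.eval (2 ^ k * hiOf bb zt rest + n) := by
    intro n hn
    obtain ⟨hb, ht⟩ := testBit_hiOf k bb zt rest hn
    simp only [rotSignB, iteB_eval, bitB_eval, hb, ht, hCn n hn, hq]
    cases C <;> cases bb <;> cases zt <;> rfl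
  have hcnt : (((Finset.range (2 ^ k)).filter fun n => (rotSignB k ctl pd p10 p01).eval (2 ^ k * hiOf bb zt rest + n) = true).card) =
      cnt k q (hiOf bb zt rest) := by
    unfold cnt; exact congrArg _ (Finset.filter_congr fun n hn => by rw [hsel n (Finset.mem_range.1 hn)])
  rw [hcnt]
  -- the selected entry
  set v : ℝ := if C then (if bb then (if zt then -g01 else -g10) else -d) else (if bb then 0 else -1) with hv
  have henc : EncodesEntry k q v := by
    rw [hq, hv]
    cases C <;> cases bb <;> cases zt <;> simp only [if_true, if_false, Bool.false_eq_true]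
    exacts [encodesEntry_trueB k k, encodesEntry_trueB k k, encodesEntry_thr0B k, encodesEntry_thr0B k, hd, hd, h10, h01]
  have htarget : (-(if C then M else (1 : Matrix (Cryptography.QReg 1) (Cryptography.QReg 1) ℂ)) (fun _ => bb ^^ zt) (fun _ => zt)) = (v : ℂ) := by
    rw [hv]
    have hTF : ((fun _ => true : Cryptography.QReg 1) = fun _ => false) ↔ False :=
      ⟨fun e => by have := congrFun e 0; simp at this, False.elim⟩
    have hFT : ((fun _ => false : Cryptography.QReg 1) = fun _ => true) ↔ False :=
      ⟨fun e => by have := congrFun e 0; simp at this, False.elim⟩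
    cases C <;> cases bb <;> cases zt <;>
      simp [Matrix.one_apply, hM, hTF, hFT]
  rw [htarget]
  have e : ((1 : ℂ) - 2 * ((cnt k q (hiOf bb zt rest) : ℕ) : ℂ) / 2 ^ k) - (v : ℂ) =
      (((1 - 2 * (cnt k q (hiOf bb zt rest) : ℝ) / 2 ^ k) - v : ℝ) : ℂ) := by push_cast; ring
  rw [e, Complex.norm_real, Real.norm_eq_abs]
  exact henc _

/-! ### The phase gadget: encodings of `cos(3π/5)`, `sin(3π/5)` and the two-half entry bound -/

/-- `T₄` encodes `cos(3π/5)`. [folklore] -/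
theorem encodesEntry_thr4B (k : ℕ) : EncodesEntry k (thr4B k) (Real.cos (3 * Real.pi / 5)) := by
  rw [← one_sub_two_mul_tau4]
  exact encodesEntry_of_threshold tau_mem_unitInterval.2.2.2.1.1 tau_mem_unitInterval.2.2.2.1.2 (fun inp => thr4B_eval inp k)

/-- `T₅` encodes `sin(3π/5)`. [folklore] -/
theorem encodesEntry_thr5B (k : ℕ) : EncodesEntry k (thr5B k) (Real.sin (3 * Real.pi / 5)) := by
  rw [← one_sub_two_mul_tau5]
  exact encodesEntry_of_threshold tau_mem_unitInterval.2.2.2.2.1 tau_mem_unitInterval.2.2.2.2.2 (fun inp => thr5B_eval inp k)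

/-- **The sign predicate of a controlled phase**: the control condition `ctl` (reading only bits
`≥ k + 2`) and the selector bit (`k`) select the imaginary-part predicate `pim`, the real-part
predicate `pre`, or (control off) the identity (`true` for the real half = entry `−1` of `−1`, `T₀`
for the imaginary half = `0`). [cite: AharonovJonesLandau2009, Claim 4.1] -/
def phaseSignB (k : ℕ) (ctl pre pim : BExpr) : BExpr :=
  iteB ctl (iteB (bitB k) pim pre) (iteB (bitB k) (thr0B k) (trueB k))

/-- **The entry bound of a controlled phase gadget** (`η = 4/2^k`): with `u = if C then c else 1` and
predicates encoding `−Re c`, `−Im c`,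
`‖((1 − 2#{σ 0}/2^k) + i(1 − 2#{σ 1}/2^k)) − (−u)‖ ≤ 4/2^k`. [cite: AharonovJonesLandau2009, Claim 4.1 and Thm. 4.3] -/
theorem phaseSign_entry_bound (k : ℕ) {ctl pre pim : BExpr} (hctl : ctl.ReadsHigh (k + 2)) {c : ℂ}
    (hre : EncodesEntry k pre (-c.re)) (him : EncodesEntry k pim (-c.im)) (zt : Bool) (rest : ℕ) :
    ‖(((1 : ℂ) - 2 * (((Finset.range (2 ^ k)).filter fun n =>
        (phaseSignB k ctl pre pim).eval (2 ^ k * hiOf false zt rest + n) = true).card : ℂ) / 2 ^ k) +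
        Complex.I * ((1 : ℂ) - 2 * (((Finset.range (2 ^ k)).filter fun n =>
          (phaseSignB k ctl pre pim).eval (2 ^ k * hiOf true zt rest + n) = true).card : ℂ) / 2 ^ k)) -
        (-(if ctl.eval (2 ^ (k + 2) * rest) then c else 1))‖ ≤ 4 / 2 ^ k := by
  set C := ctl.eval (2 ^ (k + 2) * rest) with hC
  have hCn : ∀ (rb : Bool) (n : ℕ), n < 2 ^ k → ctl.eval (2 ^ k * hiOf rb zt rest + n) = C := by
    intro rb n hn
    obtain ⟨e, hlt⟩ := split_hiOf k rb zt rest hn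
    rw [e, ctl.eval_eq_of_readsHigh hctl hlt]
  set q0 : BExpr := if C then pre else trueB k with hq0
  set q1 : BExpr := if C then pim else thr0B k with hq1
  have hsel : ∀ (rb : Bool) (n : ℕ), n < 2 ^ k →
      (phaseSignB k ctl pre pim).eval (2 ^ k * hiOf rb zt rest + n) = (if rb then q1 else q0).eval (2 ^ k * hiOf rb zt rest + n) := by
    intro rb n hn
    obtain ⟨hb, -⟩ := testBit_hiOf k rb zt rest hn
    simp only [phaseSignB, iteB_eval, bitB_eval, hb, hCn rb n hn, hq0, hq1]
    cases C <;> cases rb <;> rfl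
  have hc0 : (((Finset.range (2 ^ k)).filter fun n => (phaseSignB k ctl pre pim).eval (2 ^ k * hiOf false zt rest + n) = true).card) =
      cnt k q0 (hiOf false zt rest) := by
    unfold cnt; exact congrArg _ (Finset.filter_congr fun n hn => by rw [hsel false n (Finset.mem_range.1 hn)]; rfl)
  have hc1 : (((Finset.range (2 ^ k)).filter fun n => (phaseSignB k ctl pre pim).eval (2 ^ k * hiOf true zt rest + n) = true).card) =
      cnt k q1 (hiOf true zt rest) := by
    unfold cnt; exact congrArg _ (Finset.filter_congr fun n hn => by rw [hsel true n (Finset.mem_range.1 hn)]; rfl)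
  rw [hc0, hc1]
  set v0 : ℝ := if C then -c.re else -1 with hv0
  set v1 : ℝ := if C then -c.im else 0 with hv1
  have h0 : EncodesEntry k q0 v0 := by rw [hq0, hv0]; cases C; exacts [encodesEntry_trueB k k, hre]
  have h1 : EncodesEntry k q1 v1 := by rw [hq1, hv1]; cases C; exacts [encodesEntry_thr0B k, him]
  have htarget : (-(if C then c else (1 : ℂ))) = (v0 : ℂ) + Complex.I * (v1 : ℂ) := by
    rw [hv0, hv1]; cases C
    · simp
    · simp only [if_true]; rw [← Complex.re_add_im (-c)]; simp; ring
  rw [htarget]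
  have e : ((1 : ℂ) - 2 * ((cnt k q0 (hiOf false zt rest) : ℕ) : ℂ) / 2 ^ k) +
      Complex.I * ((1 : ℂ) - 2 * ((cnt k q1 (hiOf true zt rest) : ℕ) : ℂ) / 2 ^ k) - ((v0 : ℂ) + Complex.I * (v1 : ℂ)) =
      (((1 - 2 * (cnt k q0 (hiOf false zt rest) : ℝ) / 2 ^ k) - v0 : ℝ) : ℂ) +
        Complex.I * (((1 - 2 * (cnt k q1 (hiOf true zt rest) : ℝ) / 2 ^ k) - v1 : ℝ) : ℂ) := by push_cast; ring
  rw [e]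
  calc ‖(((1 - 2 * (cnt k q0 (hiOf false zt rest) : ℝ) / 2 ^ k) - v0 : ℝ) : ℂ) +
        Complex.I * (((1 - 2 * (cnt k q1 (hiOf true zt rest) : ℝ) / 2 ^ k) - v1 : ℝ) : ℂ)‖
      ≤ ‖(((1 - 2 * (cnt k q0 (hiOf false zt rest) : ℝ) / 2 ^ k) - v0 : ℝ) : ℂ)‖ +
          ‖Complex.I * (((1 - 2 * (cnt k q1 (hiOf true zt rest) : ℝ) / 2 ^ k) - v1 : ℝ) : ℂ)‖ := norm_add_le _ _
    _ = |(1 - 2 * (cnt k q0 (hiOf false zt rest) : ℝ) / 2 ^ k) - v0| + |(1 - 2 * (cnt k q1 (hiOf true zt rest) : ℝ) / 2 ^ k) - v1| := by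
        rw [norm_mul, Complex.norm_I, one_mul, Complex.norm_real, Complex.norm_real, Real.norm_eq_abs, Real.norm_eq_abs]
    _ ≤ 2 / 2 ^ k + 2 / 2 ^ k := add_le_add (h0 _) (h1 _)
    _ = 4 / 2 ^ k := by ring

end SLP

end Literature.Computability.QuantumComplexity

end
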